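import Summits.KontsevichZagierPeriods.KontsevichZagierPeriods.Theorems.SymplecticScissorsRealOnePeriodRelationsStubRetractionConcat

/-!
# `RealOnePeriodRelations` (stmt-KontsevichZagierPeriods-10042), line `nash-retraction-thin-strip`:
# the three geometric cases of the retraction (helper file for the stub `stub_retraction`)

With HOMOTOPY COHERENCE (the statement of the stub `stub_homotopyInvariance`, taken as a
hypothesis: two `ℚ`-semialgebraic `C¹` paths on a smooth affine curve, homotopic with fixed end
points, realise `a·ω` equally modulo `M₁`), EXISTENCE OF REALISATIONS (`stub_realises`) and
EXACTNESS IN DIMENSION ONE (`stub_exactDimOne`), the three non-trivial elementary relations of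
Huber–Wüstholz are killed by the retraction `Θ`:

* `exact_case` (R3): `[a·(Z, dP, γ̃)] ≡ [ (a e)·(𝔸¹, dx, ũ) ]` where `e = P(γ̃(1)) − P(γ̃(0))` and `ũ`
  is any semialgebraic path of `𝔸¹` homotopic to the unit path — both sides are congruent to the
  constant representation `Re(a e)` on `(0,1)`;
* `pushforward_case` (R4): `[a·(Z, f^*ω′, γ̃)] ≡ [a·(Z′, ω′, γ̃′)]` whenever `f ∘ γ̃ ≃ γ̃′` — the
  chain rule identifies the first with the realisation along `f ∘ γ̃`, coherence does the rest;
* `boundary_case` (R5): `[a·ẽ₀₁] + [a·ẽ₁₂] − [a·ẽ₀₂] ∈ M₁` whenever `ẽ₀₁ ⋆ ẽ₁₂ ≃ ẽ₀₂` —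
  concatenation in the move world plus coherence.

References: A. Huber, G. Wüstholz, *Transcendence and Linear Relations of 1-Periods* (2022),
§13.1 (A)–(B), §3.3.1; M. Kontsevich, D. Zagier, *Periods* (2001), §1.2.
-/

noncomputable section

open scoped BigOperators unitInterval
open Set MeasureTheory MvPolynomial
open Literature.NumberTheory.Transcendental Literature.NumberTheory.Transcendental.CurvePeriods
open Literature.ModelTheory.ExponentialFields (IsSemialgebraic)
open Summit.KontsevichZagierPeriods.SymplecticScissors.RealOnePeriodRelationsNegative (M₁ unitDom)

namespace Summit.KontsevichZagierPeriods.SymplecticScissors.RealOnePeriodRelations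

namespace RetractionCases

variable {Z Z' : CurveData}

/-! ## The hypotheses of the line, abbreviated in docstrings: COH (coherence), REAL (realisations) -/

/-- **The constant representation** `[∫_{(0,1)} c]` for a real algebraic constant `c`.
[cite: KontsevichZagier2001, §1.1] -/
theorem exists_constRep {c : ℝ} (hc : IsAlgebraic ℚ c) :
    ∃ r : KZ.IntegralRep 1, r.domain = {z | z 0 ∈ Set.Ioo (0 : ℝ) 1} ∧ ∀ z ∈ r.domain, r.integrand z = c :=
  ⟨{ domain := unitDom
     integrand := fun _ => c
     isSemialgebraic_domain :=
       Summit.KontsevichZagierPeriods.SymplecticScissors.RealOnePeriodRelationsNegative.isSemialgebraic_unitDom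
     isSemialgebraicFunOn_integrand := isSemialgebraicFunOn_const_of_isAlgebraic
       Summit.KontsevichZagierPeriods.SymplecticScissors.RealOnePeriodRelationsNegative.isSemialgebraic_unitDom hc
     integrableOn := integrableOn_const (by
       simp [Summit.KontsevichZagierPeriods.SymplecticScissors.RealOnePeriodRelationsNegative.volume_unitDom]) },
    rfl, fun _ _ => rfl⟩

/-- The end points of homotopic paths agree. [folklore] -/
theorem endpoints_of_homotopic {γ γ' : CurvePath Z}
    (h : ∃ (x y : Z.points) (p p' : Path x y), (∀ t : I, γ.toFun t = p t) ∧
      (∀ t : I, γ'.toFun t = p' t) ∧ p.Homotopic p') :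
    γ.toFun 0 = γ'.toFun 0 ∧ γ.toFun 1 = γ'.toFun 1 := by
  obtain ⟨x, y, p, p', hp, hp', -⟩ := h
  have h0 := hp 0
  have h0' := hp' 0
  have h1 := hp 1
  have h1' := hp' 1
  rw [Set.Icc.coe_zero, Path.source] at h0 h0'
  rw [Set.Icc.coe_one, Path.target] at h1 h1'
  exact ⟨h0.trans h0'.symm, h1.trans h1'.symm⟩

/-- The realisation integrand of `c·(𝔸¹, dx, unit path)` is the constant `Re c`. [folklore] -/
theorem unitPath_integrand (c : ℂ) (t : ℝ) :
    (c * ∑ i, MvPolynomial.eval (unitPath.toFun t) (PeriodSymbol.unit.ω i) *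
      deriv (fun u => unitPath.toFun u i) t).re = c.re := by
  have hderiv : deriv (fun u : ℝ => (u : ℂ)) t = 1 := by
    have e : (fun u : ℝ => (u : ℂ)) = ⇑Complex.ofRealCLM := by funext u; simp
    rw [e, (Complex.ofRealCLM.hasDerivAt (x := t)).deriv]
    simp
  have h1 : (∑ i : Fin 1, MvPolynomial.eval (fun _ : Fin 1 => (t : ℂ)) (1 : MvPolynomial (Fin 1) ℂ) *
      deriv (fun u : ℝ => (fun _ : Fin 1 => (u : ℂ)) i) t) = 1 := by
    rw [Fin.sum_univ_one, map_one, one_mul]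
    exact hderiv
  show (c * ∑ i : Fin 1, MvPolynomial.eval (fun _ : Fin 1 => (t : ℂ)) (1 : MvPolynomial (Fin 1) ℂ) *
      deriv (fun u : ℝ => (fun _ : Fin 1 => (u : ℂ)) i) t).re = c.re
  rw [h1, mul_one]

/-- **(R3) — the exact case.** COH on `𝔸¹` and exactness in dimension one give: a realisation `r`
of `a·(Z, dP, γ̃)` along a semialgebraic `γ̃` and a realisation `r₁` of `(a e)·(𝔸¹, dx, ũ)` with
`e = P(γ̃(1)) − P(γ̃(0))` along a semialgebraic `ũ ≃ unit path` satisfy `[r] − [r₁] ∈ M₁` (both are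
congruent to `[∫₀¹ Re(a e)]`). [cite: HuberWustholz2022, §13.1 (A)] -/
theorem exact_case
    (hcoh : ∀ (Z : CurveData) (_hZ : Z.IsSmoothAffineCurve) (ω : Fin Z.n → MvPolynomial (Fin Z.n) ℂ),
      (∀ i, HasAlgCoeffs (ω i)) → ∀ (a : ℂ), IsAlgebraic ℚ a →
      ∀ (γ₀ γ₁ : CurvePath Z),
        IsSemialgebraicMapOn ℚ {z : Fin 1 → ℝ | z 0 ∈ Set.Icc (0 : ℝ) 1}
          (fun z => Fin.append (fun i => (γ₀.toFun (z 0) i).re) (fun i => (γ₀.toFun (z 0) i).im)) →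
        IsSemialgebraicMapOn ℚ {z : Fin 1 → ℝ | z 0 ∈ Set.Icc (0 : ℝ) 1}
          (fun z => Fin.append (fun i => (γ₁.toFun (z 0) i).re) (fun i => (γ₁.toFun (z 0) i).im)) →
        (∃ (x y : Z.points) (p₀ p₁ : Path x y), (∀ t : I, γ₀.toFun t = p₀ t) ∧ (∀ t : I, γ₁.toFun t = p₁ t) ∧
          p₀.Homotopic p₁) →
      ∀ (r₀ r₁ : KZ.IntegralRep 1),
        (r₀.domain = {z | z 0 ∈ Set.Ioo (0 : ℝ) 1} ∧ ∀ z ∈ r₀.domain, r₀.integrand z =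
          (a * ∑ i, MvPolynomial.eval (γ₀.toFun (z 0)) (ω i) * deriv (fun u => γ₀.toFun u i) (z 0)).re) →
        (r₁.domain = {z | z 0 ∈ Set.Ioo (0 : ℝ) 1} ∧ ∀ z ∈ r₁.domain, r₁.integrand z =
          (a * ∑ i, MvPolynomial.eval (γ₁.toFun (z 0)) (ω i) * deriv (fun u => γ₁.toFun u i) (z 0)).re) →
        KZ.of r₀ - KZ.of r₁ ∈ M₁)
    (hexact : ∀ (u : ℝ → ℝ), IsSemialgebraicFunOn ℚ {z : Fin 1 → ℝ | z 0 ∈ Set.Icc (0 : ℝ) 1}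
        (fun z => u (z 0)) → ContDiffOn ℝ 1 u (Set.Icc (0 : ℝ) 1) →
      ∀ (r r' : KZ.IntegralRep 1), r.domain = {z | z 0 ∈ Set.Ioo (0 : ℝ) 1} →
        r'.domain = {z | z 0 ∈ Set.Ioo (0 : ℝ) 1} →
        (∀ z ∈ r.domain, r.integrand z = deriv u (z 0)) → (∀ z ∈ r'.domain, r'.integrand z = u 1 - u 0) →
        KZ.of r - KZ.of r' ∈ M₁)
    (P : MvPolynomial (Fin Z.n) ℂ) (hP : HasAlgCoeffs P) (a : ℂ) (ha : IsAlgebraic ℚ a)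
    (γ : CurvePath Z)
    (hγ : IsSemialgebraicMapOn ℚ {z : Fin 1 → ℝ | z 0 ∈ Set.Icc (0 : ℝ) 1}
      (fun z => Fin.append (fun i => (γ.toFun (z 0) i).re) (fun i => (γ.toFun (z 0) i).im)))
    (u : CurvePath CurveData.affineLine)
    (hu : IsSemialgebraicMapOn ℚ {z : Fin 1 → ℝ | z 0 ∈ Set.Icc (0 : ℝ) 1}
      (fun z => Fin.append (fun i => (u.toFun (z 0) i).re) (fun i => (u.toFun (z 0) i).im)))
    (huh : ∃ (x y : CurveData.affineLine.points) (p p' : Path x y), (∀ t : I, u.toFun t = p t) ∧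
      (∀ t : I, unitPath.toFun t = p' t) ∧ p.Homotopic p')
    (r r₁ : KZ.IntegralRep 1)
    (hr : r.domain = {z | z 0 ∈ Set.Ioo (0 : ℝ) 1} ∧ ∀ z ∈ r.domain, r.integrand z =
      (a * ∑ i, MvPolynomial.eval (γ.toFun (z 0)) (formD P i) * deriv (fun u => γ.toFun u i) (z 0)).re)
    (hr₁ : r₁.domain = {z | z 0 ∈ Set.Ioo (0 : ℝ) 1} ∧ ∀ z ∈ r₁.domain, r₁.integrand z =
      (a * (MvPolynomial.eval (γ.toFun 1) P - MvPolynomial.eval (γ.toFun 0) P) *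
        ∑ i, MvPolynomial.eval (u.toFun (z 0)) (PeriodSymbol.unit.ω i) * deriv (fun v => u.toFun v i) (z 0)).re) :
    KZ.of r - KZ.of r₁ ∈ M₁ := by
  set e : ℂ := MvPolynomial.eval (γ.toFun 1) P - MvPolynomial.eval (γ.toFun 0) P with he
  have he_alg : IsAlgebraic ℚ e := (hP.isAlgebraic_eval γ.algebraic_one).sub (hP.isAlgebraic_eval γ.algebraic_zero)
  have hae := isAlgebraic_re_im (ha.mul he_alg)
  -- the constant representation `Re(a e)`
  obtain ⟨c, hcdom, hcint⟩ := exists_constRep hae.1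
  -- `[r] − [c] ∈ M₁` by exactness in dimension one
  have h1 : KZ.of r - KZ.of c ∈ M₁ :=
    RetractionPaths.exact_move hexact P hP a ha γ hγ r c hr ⟨hcdom, fun z hz => by rw [hcint z hz]⟩
  -- `[r₁] − [c] ∈ M₁` by coherence on `𝔸¹` with the unit path, along which the integrand is `Re(a e)`
  have h2 : KZ.of r₁ - KZ.of c ∈ M₁ :=
    hcoh CurveData.affineLine CurveData.isSmoothAffineCurve_affineLine PeriodSymbol.unit.ω
      PeriodSymbol.unit.ω_algebraic (a * e) (ha.mul he_alg) u unitPath hu RetractionConcat.isSAPath_unitPath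
      huh r₁ c hr₁ ⟨hcdom, fun z hz => by rw [hcint z hz]; exact (unitPath_integrand (a * e) (z 0)).symm⟩
  have h := M₁.sub_mem h1 h2
  rwa [sub_sub_sub_cancel_right] at h

/-- **(R4) — the pushforward case.** COH on `Z′` and REAL give: a realisation `r` of
`a·(Z, f^*ω′, γ̃)` (`γ̃` semialgebraic on `Z`) and a realisation `r′` of `a·(Z′, ω′, γ̃′)` (`γ̃′`
semialgebraic on `Z′`) satisfy `[r] − [r′] ∈ M₁` as soon as `f ∘ γ̃ ≃ γ̃′`.
[cite: HuberWustholz2022, §13.1 (B)] -/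
theorem pushforward_case
    (hcoh : ∀ (Z : CurveData) (_hZ : Z.IsSmoothAffineCurve) (ω : Fin Z.n → MvPolynomial (Fin Z.n) ℂ),
      (∀ i, HasAlgCoeffs (ω i)) → ∀ (a : ℂ), IsAlgebraic ℚ a →
      ∀ (γ₀ γ₁ : CurvePath Z),
        IsSemialgebraicMapOn ℚ {z : Fin 1 → ℝ | z 0 ∈ Set.Icc (0 : ℝ) 1}
          (fun z => Fin.append (fun i => (γ₀.toFun (z 0) i).re) (fun i => (γ₀.toFun (z 0) i).im)) →
        IsSemialgebraicMapOn ℚ {z : Fin 1 → ℝ | z 0 ∈ Set.Icc (0 : ℝ) 1}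
          (fun z => Fin.append (fun i => (γ₁.toFun (z 0) i).re) (fun i => (γ₁.toFun (z 0) i).im)) →
        (∃ (x y : Z.points) (p₀ p₁ : Path x y), (∀ t : I, γ₀.toFun t = p₀ t) ∧ (∀ t : I, γ₁.toFun t = p₁ t) ∧
          p₀.Homotopic p₁) →
      ∀ (r₀ r₁ : KZ.IntegralRep 1),
        (r₀.domain = {z | z 0 ∈ Set.Ioo (0 : ℝ) 1} ∧ ∀ z ∈ r₀.domain, r₀.integrand z =
          (a * ∑ i, MvPolynomial.eval (γ₀.toFun (z 0)) (ω i) * deriv (fun u => γ₀.toFun u i) (z 0)).re) →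
        (r₁.domain = {z | z 0 ∈ Set.Ioo (0 : ℝ) 1} ∧ ∀ z ∈ r₁.domain, r₁.integrand z =
          (a * ∑ i, MvPolynomial.eval (γ₁.toFun (z 0)) (ω i) * deriv (fun u => γ₁.toFun u i) (z 0)).re) →
        KZ.of r₀ - KZ.of r₁ ∈ M₁)
    (hreal : ∀ (Z : CurveData) (γ : CurvePath Z),
      IsSemialgebraicMapOn ℚ {z : Fin 1 → ℝ | z 0 ∈ Set.Icc (0 : ℝ) 1}
        (fun z => Fin.append (fun i => (γ.toFun (z 0) i).re) (fun i => (γ.toFun (z 0) i).im)) →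
      ∀ (ω : Fin Z.n → MvPolynomial (Fin Z.n) ℂ), (∀ i, HasAlgCoeffs (ω i)) → ∀ (a : ℂ), IsAlgebraic ℚ a →
      ∃ r : KZ.IntegralRep 1, r.domain = {z | z 0 ∈ Set.Ioo (0 : ℝ) 1} ∧ ∀ z ∈ r.domain, r.integrand z =
        (a * ∑ i, MvPolynomial.eval (γ.toFun (z 0)) (ω i) * deriv (fun u => γ.toFun u i) (z 0)).re)
    (hZ' : Z'.IsSmoothAffineCurve) (f : Fin Z'.n → MvPolynomial (Fin Z.n) ℂ) (hf : ∀ j, HasAlgCoeffs (f j))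
    (hfZ : ∀ z ∈ Z.points, (fun j => eval z (f j)) ∈ Z'.points)
    (ω' : Fin Z'.n → MvPolynomial (Fin Z'.n) ℂ) (h' : ∀ j, HasAlgCoeffs (ω' j))
    (a : ℂ) (ha : IsAlgebraic ℚ a) (γ : CurvePath Z)
    (hγ : IsSemialgebraicMapOn ℚ {z : Fin 1 → ℝ | z 0 ∈ Set.Icc (0 : ℝ) 1}
      (fun z => Fin.append (fun i => (γ.toFun (z 0) i).re) (fun i => (γ.toFun (z 0) i).im)))
    (γ' : CurvePath Z')
    (hγ' : IsSemialgebraicMapOn ℚ {z : Fin 1 → ℝ | z 0 ∈ Set.Icc (0 : ℝ) 1}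
      (fun z => Fin.append (fun i => (γ'.toFun (z 0) i).re) (fun i => (γ'.toFun (z 0) i).im)))
    (hhom : ∀ δ : CurvePath Z', (∀ t, δ.toFun t = fun j => eval (γ.toFun t) (f j)) →
      ∃ (x y : Z'.points) (p p' : Path x y), (∀ t : I, δ.toFun t = p t) ∧ (∀ t : I, γ'.toFun t = p' t) ∧
        p.Homotopic p')
    (r r' : KZ.IntegralRep 1)
    (hr : r.domain = {z | z 0 ∈ Set.Ioo (0 : ℝ) 1} ∧ ∀ z ∈ r.domain, r.integrand z =
      (a * ∑ i, MvPolynomial.eval (γ.toFun (z 0)) (formPullback f ω' i) * deriv (fun u => γ.toFun u i) (z 0)).re)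
    (hr' : r'.domain = {z | z 0 ∈ Set.Ioo (0 : ℝ) 1} ∧ ∀ z ∈ r'.domain, r'.integrand z =
      (a * ∑ j, MvPolynomial.eval (γ'.toFun (z 0)) (ω' j) * deriv (fun u => γ'.toFun u j) (z 0)).re) :
    KZ.of r - KZ.of r' ∈ M₁ := by
  -- the image path `δ = f ∘ γ` and a realisation along it
  obtain ⟨δ, hδ⟩ := RetractionPaths.exists_mapPath f hf hfZ γ
  have hδsa := RetractionPaths.isSAPath_map f hf γ hγ δ hδ
  obtain ⟨rδ, hrδ⟩ := hreal Z' δ hδsa ω' h' a ha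
  -- chain rule: `[r] ≡ [rδ]`
  have h1 : KZ.of r - KZ.of rδ ∈ M₁ :=
    RetractionPaths.pullback_move f ω' a γ δ (fun t _ => hδ t) r rδ hr hrδ
  -- coherence: `[rδ] ≡ [r']`
  have h2 : KZ.of rδ - KZ.of r' ∈ M₁ := hcoh Z' hZ' ω' h' a ha δ γ' hδsa hγ' (hhom δ hδ) rδ r' hrδ hr'
  have h := M₁.add_mem h1 h2
  rwa [sub_add_sub_cancel] at h

/-- **(R5) — the boundary case.** COH on `Z` and REAL give: realisations `r₀₁, r₁₂, r₀₂` of `a·ω`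
along semialgebraic paths `ẽ₀₁, ẽ₁₂, ẽ₀₂` with `ẽ₀₁(1) = ẽ₁₂(0)` and `ẽ₀₁ ⋆ ẽ₁₂ ≃ ẽ₀₂` satisfy
`[r₀₁] + [r₁₂] − [r₀₂] ∈ M₁`. [cite: HuberWustholz2022, §3.3.1] -/
theorem boundary_case
    (hcoh : ∀ (Z : CurveData) (_hZ : Z.IsSmoothAffineCurve) (ω : Fin Z.n → MvPolynomial (Fin Z.n) ℂ),
      (∀ i, HasAlgCoeffs (ω i)) → ∀ (a : ℂ), IsAlgebraic ℚ a →
      ∀ (γ₀ γ₁ : CurvePath Z),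
        IsSemialgebraicMapOn ℚ {z : Fin 1 → ℝ | z 0 ∈ Set.Icc (0 : ℝ) 1}
          (fun z => Fin.append (fun i => (γ₀.toFun (z 0) i).re) (fun i => (γ₀.toFun (z 0) i).im)) →
        IsSemialgebraicMapOn ℚ {z : Fin 1 → ℝ | z 0 ∈ Set.Icc (0 : ℝ) 1}
          (fun z => Fin.append (fun i => (γ₁.toFun (z 0) i).re) (fun i => (γ₁.toFun (z 0) i).im)) →
        (∃ (x y : Z.points) (p₀ p₁ : Path x y), (∀ t : I, γ₀.toFun t = p₀ t) ∧ (∀ t : I, γ₁.toFun t = p₁ t) ∧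
          p₀.Homotopic p₁) →
      ∀ (r₀ r₁ : KZ.IntegralRep 1),
        (r₀.domain = {z | z 0 ∈ Set.Ioo (0 : ℝ) 1} ∧ ∀ z ∈ r₀.domain, r₀.integrand z =
          (a * ∑ i, MvPolynomial.eval (γ₀.toFun (z 0)) (ω i) * deriv (fun u => γ₀.toFun u i) (z 0)).re) →
        (r₁.domain = {z | z 0 ∈ Set.Ioo (0 : ℝ) 1} ∧ ∀ z ∈ r₁.domain, r₁.integrand z =
          (a * ∑ i, MvPolynomial.eval (γ₁.toFun (z 0)) (ω i) * deriv (fun u => γ₁.toFun u i) (z 0)).re) →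
        KZ.of r₀ - KZ.of r₁ ∈ M₁)
    (hreal : ∀ (Z : CurveData) (γ : CurvePath Z),
      IsSemialgebraicMapOn ℚ {z : Fin 1 → ℝ | z 0 ∈ Set.Icc (0 : ℝ) 1}
        (fun z => Fin.append (fun i => (γ.toFun (z 0) i).re) (fun i => (γ.toFun (z 0) i).im)) →
      ∀ (ω : Fin Z.n → MvPolynomial (Fin Z.n) ℂ), (∀ i, HasAlgCoeffs (ω i)) → ∀ (a : ℂ), IsAlgebraic ℚ a →
      ∃ r : KZ.IntegralRep 1, r.domain = {z | z 0 ∈ Set.Ioo (0 : ℝ) 1} ∧ ∀ z ∈ r.domain, r.integrand z =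
        (a * ∑ i, MvPolynomial.eval (γ.toFun (z 0)) (ω i) * deriv (fun u => γ.toFun u i) (z 0)).re)
    (hZ : Z.IsSmoothAffineCurve) (ω : Fin Z.n → MvPolynomial (Fin Z.n) ℂ) (hω : ∀ i, HasAlgCoeffs (ω i))
    (a : ℂ) (ha : IsAlgebraic ℚ a) (e₀₁ e₁₂ e₀₂ : CurvePath Z) (hj : e₀₁.toFun 1 = e₁₂.toFun 0)
    (h₀₁ : IsSemialgebraicMapOn ℚ {z : Fin 1 → ℝ | z 0 ∈ Set.Icc (0 : ℝ) 1}
      (fun z => Fin.append (fun i => (e₀₁.toFun (z 0) i).re) (fun i => (e₀₁.toFun (z 0) i).im)))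
    (h₁₂ : IsSemialgebraicMapOn ℚ {z : Fin 1 → ℝ | z 0 ∈ Set.Icc (0 : ℝ) 1}
      (fun z => Fin.append (fun i => (e₁₂.toFun (z 0) i).re) (fun i => (e₁₂.toFun (z 0) i).im)))
    (h₀₂ : IsSemialgebraicMapOn ℚ {z : Fin 1 → ℝ | z 0 ∈ Set.Icc (0 : ℝ) 1}
      (fun z => Fin.append (fun i => (e₀₂.toFun (z 0) i).re) (fun i => (e₀₂.toFun (z 0) i).im)))
    (hhom : ∃ (x y : Z.points) (p p' : Path x y), (∀ t : I, (e₀₁.concat e₁₂ hj).toFun t = p t) ∧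
      (∀ t : I, e₀₂.toFun t = p' t) ∧ p.Homotopic p')
    (r₀₁ r₁₂ r₀₂ : KZ.IntegralRep 1)
    (hr₀₁ : r₀₁.domain = {z | z 0 ∈ Set.Ioo (0 : ℝ) 1} ∧ ∀ z ∈ r₀₁.domain, r₀₁.integrand z =
      (a * ∑ i, MvPolynomial.eval (e₀₁.toFun (z 0)) (ω i) * deriv (fun u => e₀₁.toFun u i) (z 0)).re)
    (hr₁₂ : r₁₂.domain = {z | z 0 ∈ Set.Ioo (0 : ℝ) 1} ∧ ∀ z ∈ r₁₂.domain, r₁₂.integrand z =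
      (a * ∑ i, MvPolynomial.eval (e₁₂.toFun (z 0)) (ω i) * deriv (fun u => e₁₂.toFun u i) (z 0)).re)
    (hr₀₂ : r₀₂.domain = {z | z 0 ∈ Set.Ioo (0 : ℝ) 1} ∧ ∀ z ∈ r₀₂.domain, r₀₂.integrand z =
      (a * ∑ i, MvPolynomial.eval (e₀₂.toFun (z 0)) (ω i) * deriv (fun u => e₀₂.toFun u i) (z 0)).re) :
    KZ.of r₀₁ + KZ.of r₁₂ - KZ.of r₀₂ ∈ M₁ := by
  -- a realisation along the concatenation
  have hκsa := helper_saPathSubset_1 e₀₁ e₁₂ hj h₀₁ h₁₂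
  obtain ⟨rκ, hrκ⟩ := hreal Z (e₀₁.concat e₁₂ hj) hκsa ω hω a ha
  -- `[rκ] ≡ [r₀₁] + [r₁₂]`
  have h1 := RetractionConcat.concat_move e₀₁ e₁₂ hj ω a rκ r₀₁ r₁₂ hrκ hr₀₁ hr₁₂
  -- `[rκ] ≡ [r₀₂]` by coherence
  have h2 : KZ.of rκ - KZ.of r₀₂ ∈ M₁ := hcoh Z hZ ω hω a ha _ e₀₂ hκsa h₀₂ hhom rκ r₀₂ hrκ hr₀₂
  have h := M₁.sub_mem h2 h1
  have he : KZ.of rκ - KZ.of r₀₂ - (KZ.of rκ - KZ.of r₀₁ - KZ.of r₁₂) = KZ.of r₀₁ + KZ.of r₁₂ - KZ.of r₀₂ := by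
    abel
  rwa [he] at h

end RetractionCases

/-- HELPER ANCHOR of this file (registered on stmt-KontsevichZagierPeriods-10042): constant
representations of real algebraic numbers on `(0,1)`. [cite: KontsevichZagier2001, §1.1] -/
theorem helper_retractionCases_constRep : ∀ {c : ℝ}, IsAlgebraic ℚ c → ∃ r : KZ.IntegralRep 1, r.domain = {z | z 0 ∈ Set.Ioo (0 : ℝ) 1} ∧ ∀ z ∈ r.domain, r.integrand z = c :=
  fun hc => RetractionCases.exists_constRep hc

end Summit.KontsevichZagierPeriods.SymplecticScissors.RealOnePeriodRelations

end
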